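import Mathlib.Tactic.Linarith
import Mathlib.Tactic.Ring
import Mathlib.Tactic.NormNum
import Mathlib.Tactic.IntervalCases
import Mathlib.Tactic.Positivity
import Mathlib.Algebra.BigOperators.Group.Finset.Basic
import Mathlib.Data.Nat.Choose.Basic
import HarnessLib

/-!
# The (0,1) cell of the ι-window, EXISTENCE side, XVI: the 2Θ-habitat on a general ppav fourfold — arithmetic skeleton of
# `H2-EXISTENCE-SIDE-16.md`

Family `hodge`, b2b cell `hweil`, `Summits/HodgeConjecture/HodgeConjecture/Theorems` (helper of item stmt-HodgeConjecture-2524, the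
Weil-sixfold rung the H2 test serves). Companion to `WeilTypeLadderH2W2Corner*.lean` ([VI]–[XV]) but on a NEW habitat, valid on every
principally polarised abelian fourfold `(A, Θ)` (not only on `J(C)`): rank-one reflexive sheaves `𝒪_D(W)` on an irreducible normal member
`D ∈ |2Θ|` through theta-intersection surfaces `S_a = Θ_a ∩ Θ_{−a}` (class `θ²`, `K_S = 2θ|_S`), computed on the small resolution
`f : D̃ = Bl_{S_a} D → D → A` (`H := f^*θ`; the 24 nodes of `D` on `S_a` are the zeros of a normal section, `c₂(N_{S_a/A}) = θ⁴ = 24`;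
exceptional lines `ℓ_j`, `S̃ = Bl_{24}(S)`, `N_{S̃/D̃} = Σ e_j`). Dictionary of numbers: `θ⁴ = 24`, `γ = θ³/6` (`θ·γ = 4`), `H³ = 48`, `H²·S̃ = 24`,
`H·S̃² = 0`, `S̃³ = −24`, `ℓ·S̃ = −1`, `χ(𝒪_D) = −16`, `H·c₂(D̃) = 192`, `S̃·c₂(D̃) = 120`; the H2 targets `2w₀·e^{mθ} = (0, 2, 2+4m, 6m²+6m, 8m³+12m²−2)`.
Report `run/shared/lean/b2b/hodge-weil/b2b-hweil-pv3-g23/H2-EXISTENCE-SIDE-16.md`: THEOREM A (the v-vector of `i_*𝒪_D(kΘ + Σ n_i S_{a_i})` depends on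
`(k, N = Σ n_i)` only: `v₂ = 2(2k+N−2)`, `v₃ = 6k(k+N) − 6(2k+N) + 8`, `v₄ = 8k³+12k²N−4N³−24k²−24kN+32k+18N−16 (+ node term)`); COROLLARY A1
(THE PURITY OBSTRUCTION: an H2-numerical `𝒪_D(W)` needs `W̃²·H = 16(3m²+9m+5) ≡ 32 (mod 48)`, while `W̃²·H = 48k(k+N) ≡ 0 (mod 48)` on `⟨Θ, S_i⟩` —
no pure object in the habitat, on any ppav fourfold); COROLLARY A2 (the junk is forced: class exactly `2γ`, `χ = 8m+4`, hulls `𝒪_D(Θ+S)`/`𝒪_D(2Θ−S)` at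
`m = 0`, `T = 𝓛|_Z` of degree 12, `(S·Z)_D = 4`); PROPOSITION B (incidence dimension table: only `(h⁺, d′, ρ) = (5, 0, 3)` allows a component of
dimension `≤ 1`); PROPOSITION C (the bitangent locus of `Kum(A) ⊂ ℙ¹⁵`: expected dimension `8 − 7 = 1`, Porteous coefficient `2⁷·35·70 = 313600`). Code
`run/shared/lean/b2b/hodge-weil/code/pv3-g23/twotheta16.py` (900 exact checks). Def-free, fully proved ELEMENTARY statements (polynomial identities in
a commutative ring, Riemann–Roch / intersection-number bookkeeping, residues mod 48 / 6 / 3, a finite table); the sheaf theory and the geometry are in the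
docstrings and the report. HONEST FRAMING: structure / census results about one cell of the ladder's H2 test on the existence side; no case of the Hodge
conjecture is proved; nothing here is a rung; no statement of [Markman 2025] is used; nothing here depends on (LP), (8.3.3), (GP17), (GP18) or (S).

§1 the linear system (`lambda_dim_count`, `node_quadratic_part`, `ruling_planes_on_cone`, `blowup_chart_strict_transform`); §2 THEOREM A
(`vtwo_from_QW`, `vthree_from_PW`, `hrr_twelve_chi`, `node_correction_values`, `v_vector_cartier_check`, `v_vector_ideal_check`,
`v_vector_serre_duality`), COROLLARY A1 (`h2_target_vector`, `purity_PW_formula`, `purity_residue_32`, `theta_span_residue_0`,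
`purity_obstruction`, `vthree_mod_six`, `purity_diophantine_mod_three`), COROLLARY A2 (`junk_parabola_nonneg`, `junk_parabola_neg`, `junk_chi_u_one`,
`junk_chi_u_two`, `hulls_at_m_zero`, `junk_degree_bookkeeping`); §3 PROPOSITION B (`incidence_dimension_table`); §4 PROPOSITION C
(`bitangent_expected_dimension`, `porteous_coefficient`, `line_bundle_branch_parity`).

What is NOT here: sheaves, `D`, `D̃`, `S_a`, the Kummer variety, the Ext groups, the families. 0 unconditional rungs above the floor.
-/

set_option linter.dupNamespace false

open Finset

namespace Summit.HodgeConjecture.HodgeConjecture.WeilTypeLadder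

section H2TwoThetaHabitat

/-- LEMMA 1.1 (report): `dim Λ_a = 5` for `Λ_a = H⁰(A, 𝓘_{S_a}(2Θ))`. From the Koszul sequence
`0 → 𝒪_A → 𝒪_A(Θ_a) ⊕ 𝒪_A(Θ_{−a}) → 𝓘_{S_a}(2Θ) → 0` (theorem of the square) and `h⁰(𝒪_A) = 1`, `h⁰(𝒪(Θ_{±a})) = 1`, `h¹(𝒪_A) = 4`,
`h¹(𝒪(Θ_{±a})) = 0`: `dim Λ_a = (1 + 1) − 1 + 4 = 5` — the line `k·θ_aθ_{−a}` plus the four derivatives `W_v`, i.e. `ℙ(Λ_a)` is the embedded tangent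
`ℙ⁴` of the Kummer fourfold in `|2Θ| ≅ ℙ¹⁵`. Recorded: the dimension count of the exact sequence. [§1.1–1.2] -/
theorem lambda_dim_count (h0O h0a h0b h1O lam : ℕ) (e0 : h0O = 1) (ea : h0a = 1) (eb : h0b = 1) (e1 : h1O = 4)
    (hex : lam + h0O = h0a + h0b + h1O) : lam = 5 := by
  subst e0; subst ea; subst eb; subst e1; omega

/-- PROPOSITION 1.4 (b) (report): at a zero `x ∈ S_a` of the normal section `σ_v` the quadratic part of the member
`λθ_aθ_{−a} + W_v = λθ_aθ_{−a} + (∂_vθ_a)θ_{−a} − θ_a(∂_vθ_{−a})` is, in the linear forms `ℓ₁ = dθ_a`, `ℓ₂ = dθ_{−a}`, `m₁ = d(∂_vθ_a)`,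
`m₂ = d(∂_vθ_{−a})`, the determinantal form `ℓ₂(m₁ + λℓ₁) − ℓ₁m₂`; in coordinates `(x,y,z,w) = (ℓ₁, ℓ₂, m₁ + λℓ₁, m₂)` it is `yz − xw`: the
node `xw = yz`, nondegenerate iff the four forms are independent iff `x` is a nondegenerate zero of `σ_v`. Recorded: the identity in any commutative
ring. [§1.4] -/
theorem node_quadratic_part {R : Type} [CommRing R] (l1 l2 m1 m2 lam : R) :
    lam * l1 * l2 + m1 * l2 - l1 * m2 = l2 * (m1 + lam * l1) - l1 * m2 := by
  ring

/-- PROPOSITION 1.4 (b) / REMARK (report): on the cone `xw = yz` the planes `{x = t z, y = t w}` (first ruling; `t = 0` is `T_xS_a = {x = y = 0}`)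
and `{x = s y, z = s w}` (second ruling; `s = 0` is the polar surface `Γ_v(a) = {x = z = 0}`, `s = ∞` is `Γ_v(−a) = {y = w = 0}`) lie on the cone:
the theta-intersection `S_a` and the two polar surfaces pass through each node as planes, `S_a` of one ruling and `Γ_v(±a)` of the other
(local classes `+1, −1, −1`, consistent with `Θ_a|_D = S_a + Γ_v(a)` Cartier). Recorded: both parametrised planes satisfy `xw − yz = 0`. [§1.4, §1.6] -/
theorem ruling_planes_on_cone {R : Type} [CommRing R] (y z w t s : R) :
    (t * z) * w - (t * w) * z = 0 ∧ (s * y) * w - y * (s * w) = 0 := by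
  constructor <;> ring

/-- §2.2 (report): the small resolution `Bl_S D` in the chart `x = μ y`: `xw − yz = y(μw − z)`, so the strict transform is `{z = μw}` (smooth,
coordinates `(y, w, μ)`), the exceptional curve is `ℓ = {y = w = 0} ≅ ℙ¹_μ`, the strict transform of `S = {x = y = 0}` is `{y = 0} ≅ Bl_x S`
(`z = μw`: the blow-up chart) and contains `ℓ`; a second theta-intersection `S′ = {z = w = 0}` (same ruling) has strict transform `{w = 0} ⊃ ℓ`.
Recorded: the factorisation. [§2.2] -/
theorem blowup_chart_strict_transform {R : Type} [CommRing R] (y z w mu : R) :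
    (mu * y) * w - y * z = y * (mu * w - z) := by
  ring

/-- THEOREM A (report), degree 2: for `W = kΘ|_D + Σ n_i S_{a_i}` with `N = Σ n_i` one has `Q_W := W̃·H² = 48k + 24N` (`H³ = 48`, `H²·S̃_i = 24`) and
`12·v₂ = Q_W − 48` (`ch₂ = f_*(W̃) − f_*(H)`), i.e. `v₂ = 2(2k + N − 2)`. Recorded: the identity. [§2.3] -/
theorem vtwo_from_QW (k N : ℤ) : (48 * k + 24 * N) - 48 = 12 * (2 * (2 * k + N - 2)) := by
  ring

/-- THEOREM A (report), degree 3: `P_W := W̃²·H = 48k² + 48kN` (`H·S̃_i² = 0`, `H·S̃_iS̃_j = 0`) and `4·v₃ = P_W/2 − Q_W + 32`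
(`ch₃ = f_*(W̃²/2 − W̃H + (4H² + c₂)/12)`, `θ·f_*(4H² + c₂) = 192 + 192`), i.e. `8·v₃ = P_W − 2Q_W + 64` and `v₃ = 6k(k + N) − 6(2k + N) + 8`.
Recorded: the identity. [§2.3] -/
theorem vthree_from_PW (k N : ℤ) :
    (48 * k ^ 2 + 48 * k * N) - 2 * (48 * k + 24 * N) + 64 = 8 * (6 * k * (k + N) - 6 * (2 * k + N) + 8) := by
  ring

/-- THEOREM A (report), degree 4: Hirzebruch–Riemann–Roch on `D̃` with `c₁(D̃) = −2H`:
`12·χ(𝒪(W̃)) = 2W̃³ − 6W̃²H + W̃·(4H² + c₂) − H·c₂` with `W̃³ = 48k³ + 72k²N − 24N³`, `W̃²H = 48k² + 48kN`, `W̃H² = 48k + 24N`,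
`W̃·c₂ = 192k + 120N`, `H·c₂ = 192`; hence `χ = 8k³ + 12k²N − 4N³ − 24k² − 24kN + 32k + 18N − 16` (to which the node term `24·(N³−N)/6` is added for
`N ≥ 2`). Recorded: the identity. [§2.3] -/
theorem hrr_twelve_chi (k N : ℤ) :
    2 * (48 * k ^ 3 + 72 * k ^ 2 * N - 24 * N ^ 3) - 6 * (48 * k ^ 2 + 48 * k * N)
      + (4 * (48 * k + 24 * N) + (192 * k + 120 * N)) - 192
    = 12 * (8 * k ^ 3 + 12 * k ^ 2 * N - 4 * N ^ 3 - 24 * k ^ 2 - 24 * k * N + 32 * k + 18 * N - 16) := by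
  ring

/-- §2.2 (d) (report): the length of `R¹π_*𝒪(W̃)` at a node, for `W̃·ℓ = −n ≤ −2`, by formal functions along the `(−1,−1)`-curve:
`Σ_{m=0}^{n−2} (m+1)(n−1−m) = (n³ − n)/6`; the values used: `n = 2 ↦ 1`, `n = 3 ↦ 4`, `n = 4 ↦ 10`, `n = 5 ↦ 20`. Recorded: the four sums and the
closed form at these `n`. [§2.2 (d)] -/
theorem node_correction_values :
    (∑ m ∈ range 1, (m + 1) * (2 - 1 - m)) = 1 ∧ (∑ m ∈ range 2, (m + 1) * (3 - 1 - m)) = 4 ∧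
    (∑ m ∈ range 3, (m + 1) * (4 - 1 - m)) = 10 ∧ (∑ m ∈ range 4, (m + 1) * (5 - 1 - m)) = 20 ∧
    (2 ^ 3 - 2) / 6 = 1 ∧ (3 ^ 3 - 3) / 6 = 4 ∧ (4 ^ 3 - 4) / 6 = 10 ∧ (5 ^ 3 - 5) / 6 = 20 := by
  refine ⟨?_, ?_, ?_, ?_, ?_, ?_, ?_, ?_⟩ <;> decide

/-- THEOREM A, CHECK (i) (report): for `N = 0` (`W = kΘ|_D` Cartier) the formula returns `ch(i_*𝒪_D(kΘ)) = e^{kθ}(1 − e^{−2θ})`, i.e.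
`v_j = k^j − (k−2)^j` (`j = 1, 2, 3, 4`). Recorded: the four polynomial identities. [§2.3 CHECKS] -/
theorem v_vector_cartier_check (k : ℤ) :
    (2 : ℤ) = k - (k - 2) ∧ 2 * (2 * k + 0 - 2) = k ^ 2 - (k - 2) ^ 2 ∧
    6 * k * (k + 0) - 6 * (2 * k + 0) + 8 = k ^ 3 - (k - 2) ^ 3 ∧
    8 * k ^ 3 + 12 * k ^ 2 * 0 - 4 * (0 : ℤ) ^ 3 - 24 * k ^ 2 - 24 * k * 0 + 32 * k + 18 * 0 - 16 = k ^ 4 - (k - 2) ^ 4 := by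
  refine ⟨by ring, by ring, by ring, by ring⟩

/-- THEOREM A, CHECK (ii) (report): `(k, N) = (0, −1)`, i.e. `𝒪_D(−S) = 𝓘_{S/D}`: the formula gives `(2, −6, 14, −30)`, which is
`ch(𝒪_D) − ch(𝒪_S) = (0,2,−4,8,−16) − (0,0,2,−6,14)` (Koszul: `ch(𝒪_D) = 1 − e^{−2θ}`, `ch(𝒪_S) = 1 − 2e^{−θ} + e^{−2θ}`). Recorded: the arithmetic.
[§2.3 CHECKS] -/
theorem v_vector_ideal_check :
    2 * (2 * (0 : ℤ) + (-1) - 2) = -6 ∧ 6 * (0 : ℤ) * (0 + (-1)) - 6 * (2 * 0 + (-1)) + 8 = 14 ∧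
    8 * (0 : ℤ) ^ 3 + 12 * 0 ^ 2 * (-1) - 4 * (-1 : ℤ) ^ 3 - 24 * 0 ^ 2 - 24 * 0 * (-1) + 32 * 0 + 18 * (-1) - 16 = -30 ∧
    ((2 : ℤ) - 0 = 2 ∧ (-4 : ℤ) - 2 = -6 ∧ (8 : ℤ) - (-6) = 14 ∧ (-16 : ℤ) - 14 = -30) := by
  norm_num

/-- THEOREM A, CHECK (iii) (report): Serre duality on the Gorenstein `D` (`ω_D = 𝒪_D(2Θ)`, `𝒪_D(W)` Cohen–Macaulay):
`χ(𝒪_D(W)) = −χ(𝒪_D(2Θ − W))`, i.e. the polynomial part of `v₄` satisfies `v₄(k, N) = −v₄(2 − k, −N)` identically. Recorded: the identity. [§2.3 CHECKS] -/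
theorem v_vector_serre_duality (k N : ℤ) :
    8 * k ^ 3 + 12 * k ^ 2 * N - 4 * N ^ 3 - 24 * k ^ 2 - 24 * k * N + 32 * k + 18 * N - 16
      = -(8 * (2 - k) ^ 3 + 12 * (2 - k) ^ 2 * (-N) - 4 * (-N) ^ 3 - 24 * (2 - k) ^ 2 - 24 * (2 - k) * (-N)
          + 32 * (2 - k) + 18 * (-N) - 16) := by
  ring

/-- The H2 targets (report, Notation): `2w₀ = (0,2,2,0,−2)` and `2w₀·e^{mθ}` has `v₂ = 2 + 2·2·m`, `v₃ = 0 + 3·2·m + 3·2·m²`,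
`v₄ = −2 + 4·0·m + 6·2·m² + 4·2·m³`, i.e. `(0, 2, 2+4m, 6m²+6m, 8m³+12m²−2)`; the Euler form `Q = 2v₀v₄ − 8v₁v₃ + 6v₂²` is `24` on the whole family
(the H2 habitat `χ(F,F) = 24`). Recorded: the binomial bookkeeping and `Q = 24`. [Notation; `twotheta16.py` C1–C2] -/
theorem h2_target_vector (m : ℤ) :
    2 + 2 * 2 * m = 2 + 4 * m ∧ 0 + 3 * 2 * m + 3 * 2 * m ^ 2 = 6 * m ^ 2 + 6 * m ∧
    -2 + 4 * 0 * m + 6 * 2 * m ^ 2 + 4 * 2 * m ^ 3 = 8 * m ^ 3 + 12 * m ^ 2 - 2 ∧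
    2 * 0 * (8 * m ^ 3 + 12 * m ^ 2 - 2) - 8 * 2 * (6 * m ^ 2 + 6 * m) + 6 * (2 + 4 * m) ^ 2 = (24 : ℤ) := by
  refine ⟨by ring, by ring, by ring, by ring⟩

/-- COROLLARY A1 (a) (report): if `i_*𝒪_D(W)` is H2-numerical with twist `m` then `Q_W = 12(2 + 4m) + 48 = 72 + 48m` and
`P_W = 2(4(6m² + 6m) + Q_W − 32) = 16(3m² + 9m + 5)`. Recorded: the two identities. [§2.4 (a)] -/
theorem purity_PW_formula (m : ℤ) :
    12 * (2 + 4 * m) + 48 = 72 + 48 * m ∧ 2 * (4 * (6 * m ^ 2 + 6 * m) + (72 + 48 * m) - 32) = 16 * (3 * m ^ 2 + 9 * m + 5) := by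
  constructor <;> ring

/-- COROLLARY A1 (a) (report): `16(3m² + 9m + 5) = 48(m² + 3m + 1) + 32`, hence `P_W ≡ 32 (mod 48)` for every H2-numerical `𝒪_D(W)`.
Recorded: the identity and the residue. [§2.4 (a)] -/
theorem purity_residue_32 (m : ℤ) :
    16 * (3 * m ^ 2 + 9 * m + 5) = 32 + 48 * (m ^ 2 + 3 * m + 1) ∧ 16 * (3 * m ^ 2 + 9 * m + 5) % 48 = 32 := by
  have h : 16 * (3 * m ^ 2 + 9 * m + 5) = 32 + 48 * (m ^ 2 + 3 * m + 1) := by ring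
  refine ⟨h, ?_⟩
  rw [h, Int.add_mul_emod_self_left]
  norm_num

/-- COROLLARY A1 (b) (report): on the span of `Θ|_D` and theta-intersection surfaces, `P_W = 48k² + 48kN = 48·(k(k + N)) ≡ 0 (mod 48)`.
Recorded: the residue. [§2.4 (b)] -/
theorem theta_span_residue_0 (k N : ℤ) : (48 * k ^ 2 + 48 * k * N) % 48 = 0 := by
  have h : 48 * k ^ 2 + 48 * k * N = 48 * (k ^ 2 + k * N) := by ring
  rw [h, Int.mul_emod_right]

/-- COROLLARY A1 (report), THE PURITY OBSTRUCTION: no `(k, N, m)` satisfies `48k² + 48kN = 16(3m² + 9m + 5)`; hence NO sheaf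
`i_*𝒪_D(kΘ + Σ n_iS_{a_i}) ⊗ P` on any irreducible normal small-resolvable `D ∈ |2Θ|` of any ppav fourfold is H2-numerical — the pure part of the
row '(4.4) rank 1 on irreducible `D ∈ |2Θ|`' with hull in `⟨Θ, S_{a_i}⟩` is VOID (pv1-g15 14.2's '(m, n) pinned by ch₃, ch₄' is pinned to `∅`).
Recorded: the incompatibility of the residues. [§2.4] -/
theorem purity_obstruction (k N m : ℤ) : 48 * k ^ 2 + 48 * k * N ≠ 16 * (3 * m ^ 2 + 9 * m + 5) := by
  intro h
  have h1 := theta_span_residue_0 k N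
  have h2 := (purity_residue_32 m).2
  rw [h] at h1
  omega

/-- COROLLARY A1 (report), equivalent form: `v₃(i_*𝒪_D(W)) = 6k(k+N) − 6(2k+N) + 8 ≡ 2 (mod 6)` for all `(k, N)`, whereas every target has
`v₃ = 6m² + 6m ≡ 0 (mod 6)`. Recorded: both residues. [§2.4 (b)] -/
theorem vthree_mod_six (k N m : ℤ) :
    (6 * k * (k + N) - 6 * (2 * k + N) + 8) % 6 = 2 ∧ (6 * m ^ 2 + 6 * m) % 6 = 0 := by
  constructor
  · have h : 6 * k * (k + N) - 6 * (2 * k + N) + 8 = 2 + 6 * (k * (k + N) - (2 * k + N) + 1) := by ring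
    rw [h, Int.add_mul_emod_self_left]
    norm_num
  · have h : 6 * m ^ 2 + 6 * m = 6 * (m ^ 2 + m) := by ring
    rw [h, Int.mul_emod_right]

/-- COROLLARY A1 (report), Diophantine form: with `N = 3 + 2m − 2k` (the `v₂`-condition) the `v₃`-condition reads
`3k² − 6k − 6mk + 3m² + 9m + 5 = 0`, and the left side is `≡ 2 (mod 3)`. Recorded: the residue and the non-vanishing. [§2.4 (b)] -/
theorem purity_diophantine_mod_three (k m : ℤ) :
    (3 * k ^ 2 - 6 * k - 6 * m * k + 3 * m ^ 2 + 9 * m + 5) % 3 = 2 ∧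
    3 * k ^ 2 - 6 * k - 6 * m * k + 3 * m ^ 2 + 9 * m + 5 ≠ 0 := by
  have h : 3 * k ^ 2 - 6 * k - 6 * m * k + 3 * m ^ 2 + 9 * m + 5 = 2 + 3 * (k ^ 2 - 2 * k - 2 * m * k + m ^ 2 + 3 * m + 1) := by
    ring
  have hmod : (3 * k ^ 2 - 6 * k - 6 * m * k + 3 * m ^ 2 + 9 * m + 5) % 3 = 2 := by
    rw [h, Int.add_mul_emod_self_left]; norm_num
  refine ⟨hmod, ?_⟩
  intro h0
  rw [h0] at hmod
  norm_num at hmod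

/-- COROLLARY A2 (b) (report): with `u := k − m = (3 − N)/2` the class of the junk `T = 𝓛/F` is `v₃(T)·γ` with
`v₃(T) = v₃(𝓛) − (6m² + 6m) = −6u² + 18u − 10`; for `u ∈ {1, 2}` (i.e. `N ∈ {1, −1}`) this is `2`: the junk carrier has class EXACTLY `2γ`
(θ-degree 8). Recorded: the substitution identity (with `N = 3 − 2u`, `k = m + u`) and the two values. [§2.5 (b)] -/
theorem junk_parabola_nonneg (m u : ℤ) :
    6 * (m + u) * ((m + u) + (3 - 2 * u)) - 6 * (2 * (m + u) + (3 - 2 * u)) + 8 - (6 * m ^ 2 + 6 * m)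
      = -6 * u ^ 2 + 18 * u - 10 ∧
    (-6 * (1 : ℤ) ^ 2 + 18 * 1 - 10 = 2 ∧ -6 * (2 : ℤ) ^ 2 + 18 * 2 - 10 = 2) := by
  refine ⟨by ring, by norm_num, by norm_num⟩

/-- COROLLARY A2 (b) (report): for `u ≤ 0` or `u ≥ 3` the would-be junk class `−6u² + 18u − 10` is NEGATIVE (values `…, −34, −10 | 2, 2 | −10,
−34, …`), impossible for a quotient; so `N ∈ {1, −1}` is forced (and `T` is never `0`-dimensional: the value `0` does not occur). Recorded: the
sign. [§2.5 (b)] -/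
theorem junk_parabola_neg (u : ℤ) (hu : u ≤ 0 ∨ 3 ≤ u) : -6 * u ^ 2 + 18 * u - 10 < 0 := by
  rcases hu with h | h
  · nlinarith [sq_nonneg u]
  · nlinarith [sq_nonneg (u - 3)]

/-- COROLLARY A2 (c) (report), case `u = 1` (`N = 1`, `m = k − 1`): `χ(T) = v₄(𝓛) − v₄(2w₀e^{mθ}) = 8m + 4`. Recorded: the identity with
`k = m + 1`, `N = 1` (no node term: `|N| ≤ 1`). [§2.5 (c)] -/
theorem junk_chi_u_one (m : ℤ) :
    (8 * (m + 1) ^ 3 + 12 * (m + 1) ^ 2 * 1 - 4 * (1 : ℤ) ^ 3 - 24 * (m + 1) ^ 2 - 24 * (m + 1) * 1 + 32 * (m + 1) + 18 * 1 - 16)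
      - (8 * m ^ 3 + 12 * m ^ 2 - 2) = 8 * m + 4 := by
  ring

/-- COROLLARY A2 (c) (report), case `u = 2` (`N = −1`, `m = k − 2`): again `χ(T) = 8m + 4`. Recorded: the identity with `k = m + 2`, `N = −1`.
[§2.5 (c)] -/
theorem junk_chi_u_two (m : ℤ) :
    (8 * (m + 2) ^ 3 + 12 * (m + 2) ^ 2 * (-1) - 4 * (-1 : ℤ) ^ 3 - 24 * (m + 2) ^ 2 - 24 * (m + 2) * (-1) + 32 * (m + 2)
        + 18 * (-1) - 16)
      - (8 * m ^ 3 + 12 * m ^ 2 - 2) = 8 * m + 4 := by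
  ring

/-- COROLLARY A2 (d) (report): at `m = 0` the two hulls are `(k, N) = (1, 1)` — `𝒪_D(Θ + S)` — and `(2, −1)` — `𝒪_D(2Θ − S) ≅ 𝒪_D(Θ + Γ_v(a))`
up to `Pic⁰` —, both with `v = (2, 2, 2, 2)` (the vector of the `j = 2` canonical sheaves `F̂^{(a)}_b` of [XV] 3.1 on `J(C)`: equal vectors, disjoint
habitats, §5.2); the junk then has `χ = 4`. Recorded: the two evaluations. [§2.5 (d)] -/
theorem hulls_at_m_zero :
    (2 * (2 * (1 : ℤ) + 1 - 2) = 2 ∧ 6 * (1 : ℤ) * (1 + 1) - 6 * (2 * 1 + 1) + 8 = 2 ∧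
      8 * (1 : ℤ) ^ 3 + 12 * 1 ^ 2 * 1 - 4 * (1 : ℤ) ^ 3 - 24 * 1 ^ 2 - 24 * 1 * 1 + 32 * 1 + 18 * 1 - 16 = 2) ∧
    (2 * (2 * (2 : ℤ) + (-1) - 2) = 2 ∧ 6 * (2 : ℤ) * (2 + (-1)) - 6 * (2 * 2 + (-1)) + 8 = 2 ∧
      8 * (2 : ℤ) ^ 3 + 12 * 2 ^ 2 * (-1) - 4 * (-1 : ℤ) ^ 3 - 24 * 2 ^ 2 - 24 * 2 * (-1) + 32 * 2 + 18 * (-1) - 16 = 2) ∧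
    (8 * (0 : ℤ) + 4 = 4) := by
  norm_num

/-- COROLLARY A2 (e) / LEMMA 2.6 (report): the junk is `T = 𝓛|_Z` on an integral class-`2γ` carrier `Z` missing `Sing D` (`θ·Z = 8`, `p_a(Z) = 9`):
`χ(T) = 4 ⟺ deg 𝓛|_Z = 12` (`12 + 1 − 9 = 4`); for `𝓛 = 𝒪_D(Θ + S)`: `8 + (S·Z)_D = 12 ⟺ (S·Z)_D = 4`; for `𝒪_D(2Θ − S)`: `16 − (S·Z)_D = 12 ⟺
(S·Z)_D = 4`; with `Θ_a|_D = S_a + Γ_v(a)` (`8 = (S·Z)_D + (Γ·Z)_D`) the carrier is balanced, `4 + 4`; an Abel–Prym curve INSIDE `S_a` off the nodes has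
`(S·Z)_D = deg N_{S/D}|_Z = 0 ≠ 4`: void. Recorded: the bookkeeping. [§2.5 (e)(f), §2.6] -/
theorem junk_degree_bookkeeping (sz : ℤ) :
    ((12 : ℤ) + 1 - 9 = 4) ∧ (8 + sz = 12 ↔ sz = 4) ∧ (16 - sz = 12 ↔ sz = 4) ∧ ((8 : ℤ) - 4 = 4) ∧ ((0 : ℤ) ≠ 4) := by
  refine ⟨by norm_num, by omega, by omega, by norm_num, by norm_num⟩

/-- PROPOSITION B / LEMMA 3.2 (report): a component of the configuration space `𝒞 = {(a, Z, D) : Z ⊂ D ∈ ℙ(Λ_a)}` lying over a rank-`ρ` stratum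
(fibres `ℙ^{4−ρ}`) of dimension `b′ ≥ max(0, 4 + d′ − (5 − ρ)(h − ρ))` (degeneracy loci of a map from the rank-5 bundle `Λ` to a rank-`h` bundle,
`h = h⁺(Z) ≤ 5`; `d′` = dimension of the ι-stratum of the carrier family) has dimension `≥ max(0, 4 + d′ − (5 − ρ)(h − ρ)) + (4 − ρ)`. TABLE: for
`h ∈ {4, 5}`, `d′ ≤ 2`, `ρ ≤ 4` this bound is `≤ 1` ONLY for `(h, d′, ρ) = (5, 0, 3)` (the 'pencil nest'); every other component has dimension `≥ 2` and
its sheaves have `e₁^ι ≥ 2` by the family mechanism. Recorded: the finite table (natural-number truncated subtraction realises `max(0, ·)`). [§3.2] -/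
theorem incidence_dimension_table (h d r : ℕ) (hh : 4 ≤ h) (hh' : h ≤ 5) (hd : d ≤ 2) (hr : r ≤ 4)
    (hsmall : (4 + d - (5 - r) * (h - r)) + (4 - r) ≤ 1) : h = 5 ∧ d = 0 ∧ r = 3 := by
  interval_cases h <;> interval_cases d <;> interval_cases r <;> omega

/-- PROPOSITION C / 4.1, 4.4 (report): the bitangent locus `M` of the Kummer fourfold `Kum(A) ⊂ ℙ¹⁵` — pairs `(a, a′)` whose embedded tangent
`ℙ⁴`'s meet, i.e. members `D ∈ |2Θ|` containing two theta-intersections `S_a ∪ S_{a′}` — is the rank-`≤ 9` degeneracy locus of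
`Λ_a ⊕ Λ_{a′} → H⁰(2Θ)` (`10 → 16`), of expected codimension `(10 − 9)(16 − 9) = 7` in the 8-dimensional `A × A`: EXPECTED DIMENSION 1, and every
component has dimension `≥ 1`; `g = 4` is the only genus with this count equal to `1` (`g = 3`: `6 − (8 − 8 + 1) = 5`; `g = 5`: `10 − (32 − 10 + 1) < 0`).
Recorded: the counts. [§4.1, §4.4] -/
theorem bitangent_expected_dimension :
    (10 - 9) * (16 - 9) = 7 ∧ 8 - 7 = 1 ∧ 6 - (8 - 4 - 4 + 1) = 5 ∧ (10 : ℤ) - (32 - 5 - 5 + 1) < 0 := by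
  norm_num

/-- PROPOSITION C / 4.4 (report): with `c(E) = (1 − 2θ)⁵` (the bundle of affine tangent cones of the Kummer map: an extension of `T_A(−1)` by `𝒪(−1)`,
`κ^*𝒪(1) = 𝒪_A(2Θ)`), the Thom–Porteous class of the full degeneracy locus in `A × A` is the degree-7 part of `(1 − 2θ₁)^{−5}(1 − 2θ₂)^{−5}`, i.e.
`2⁷·(C(7,4)C(8,4)·θ₁³θ₂⁴ + C(8,4)C(7,4)·θ₁⁴θ₂³)` with `C(7,4)·C(8,4)·2⁷ = 35·70·128 = 313600`, and `θ³ = 6γ`, `θ⁴ = 24`: the class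
`313600·144·(γ × pt + pt × γ) = 45158400·(…)` — non-zero, supported on `M ∪ {a′ = ±a}` (the excess components are NOT separated: `M ≠ ∅` is not claimed).
Recorded: the arithmetic. [§4.4] -/
theorem porteous_coefficient :
    Nat.choose 7 4 = 35 ∧ Nat.choose 8 4 = 70 ∧ 35 * 70 * 2 ^ 7 = 313600 ∧ 6 * 24 = 144 ∧ 313600 * 144 = 45158400 := by
  refine ⟨by decide, by decide, by norm_num, by norm_num, by norm_num⟩

/-- PROPOSITION C / 4.3 (a) (report): on a bitangent member (hypothesis (H2S): `Sing D = S_a ∩ S_{a′}` = 24 nodes, both surfaces planes of the SAME ruling)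
the sheaves `𝒪_D(n(S_a − S_{a′}))` are LINE BUNDLES (`[S_a] = [S_{a′}]` in each local class group) invisible to THEOREM A (`N = n − n = 0`): their
`v`-vector is that of `𝒪_D(kΘ)`, `v₂ = 2(2k − 2) = 4(k − 1) ≡ 0 (mod 4)`, never the H2 value `2 + 4m ≡ 2 (mod 4)`. Recorded: the residues. [§4.3 (a)] -/
theorem line_bundle_branch_parity (k m : ℤ) : (2 * (2 * k + 0 - 2)) % 4 = 0 ∧ (2 + 4 * m) % 4 = 2 ∧ 2 * (2 * k + 0 - 2) ≠ 2 + 4 * m := by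
  refine ⟨by omega, by omega, by omega⟩

end H2TwoThetaHabitat

section H2TwoThetaHabitatAddendumA

/-!
### ADDENDUM A (report §7, same seat): the rank-3 reading on the same divisors

The other rank-0 member of the H2 orbit is `2w₁ = (0, 6, −6, 4, −2)` (`c₁ = 6θ`: rank 3 on a member of `|2Θ|`), with twists
`2w₁·e^{mθ} = (0, 6, 12m − 6, 18m² − 18m + 4, 24m³ − 36m² + 16m − 2)` (Euler form `24` throughout). COROLLARY A3: on the divisors `D` of THEOREM A,
a rank-3 sheaf with a filtration whose graded pieces are rank-one reflexive sheaves `𝒪_D(W_i)`, `W_i ∈ ⟨Θ, S_{a_j}⟩`, has `v₃ = Σ_i v₃(W_i) ≡ 3·2 ≡ 0 (mod 6)`,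
while every target has `v₃ ≡ 4 (mod 6)`: no such sheaf is H2-numerical in the `c₁ = 6θ` reading either.
-/

/-- ADDENDUM A (report §7.1): the second rank-0 member of the H2 orbit, `2w₁ = (0,6,−6,4,−2)`, and its twists: `v₂ = −6 + 2·6·m`, `v₃ = 4 + 3·(−6)·m + 3·6·m²`,
`v₄ = −2 + 4·4·m + 6·(−6)·m² + 4·6·m³`, i.e. `(0, 6, 12m − 6, 18m² − 18m + 4, 24m³ − 36m² + 16m − 2)`; Euler form `2v₀v₄ − 8v₁v₃ + 6v₂² = 24`.
Recorded: the bookkeeping. [§7.1] -/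
theorem h2_target_vector_rank_three (m : ℤ) :
    -6 + 2 * 6 * m = 12 * m - 6 ∧ 4 + 3 * (-6) * m + 3 * 6 * m ^ 2 = 18 * m ^ 2 - 18 * m + 4 ∧
    -2 + 4 * 4 * m + 6 * (-6) * m ^ 2 + 4 * 6 * m ^ 3 = 24 * m ^ 3 - 36 * m ^ 2 + 16 * m - 2 ∧
    2 * 0 * (24 * m ^ 3 - 36 * m ^ 2 + 16 * m - 2) - 8 * 6 * (18 * m ^ 2 - 18 * m + 4) + 6 * (12 * m - 6) ^ 2 = (24 : ℤ) := by
  refine ⟨by ring, by ring, by ring, by ring⟩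

/-- COROLLARY A3 (report §7.1): for three Weil divisors `W_i = k_iΘ|_D + Σ n_{ij} S_{a_j}` (`N_i := Σ_j n_{ij}`) the filtered rank-3 sheaf has
`v₃ = Σ_i (6k_i(k_i + N_i) − 6(2k_i + N_i) + 8) ≡ 0 (mod 6)`, whereas `2w₁e^{mθ}` has `v₃ = 18m² − 18m + 4 ≡ 4 (mod 6)`: never equal. Recorded: the two residues
and the non-equality. [§7.1] -/
theorem rank_three_filtered_obstruction (k₁ N₁ k₂ N₂ k₃ N₃ m : ℤ) :
    ((6 * k₁ * (k₁ + N₁) - 6 * (2 * k₁ + N₁) + 8) + (6 * k₂ * (k₂ + N₂) - 6 * (2 * k₂ + N₂) + 8)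
        + (6 * k₃ * (k₃ + N₃) - 6 * (2 * k₃ + N₃) + 8)) % 6 = 0 ∧
    (18 * m ^ 2 - 18 * m + 4) % 6 = 4 ∧
    ((6 * k₁ * (k₁ + N₁) - 6 * (2 * k₁ + N₁) + 8) + (6 * k₂ * (k₂ + N₂) - 6 * (2 * k₂ + N₂) + 8)
        + (6 * k₃ * (k₃ + N₃) - 6 * (2 * k₃ + N₃) + 8)) ≠ 18 * m ^ 2 - 18 * m + 4 := by
  have h1 : ((6 * k₁ * (k₁ + N₁) - 6 * (2 * k₁ + N₁) + 8) + (6 * k₂ * (k₂ + N₂) - 6 * (2 * k₂ + N₂) + 8)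
      + (6 * k₃ * (k₃ + N₃) - 6 * (2 * k₃ + N₃) + 8))
      = 0 + 6 * (k₁ * (k₁ + N₁) - (2 * k₁ + N₁) + k₂ * (k₂ + N₂) - (2 * k₂ + N₂) + k₃ * (k₃ + N₃) - (2 * k₃ + N₃) + 4) := by ring
  have h2 : 18 * m ^ 2 - 18 * m + 4 = 4 + 6 * (3 * m ^ 2 - 3 * m) := by ring
  have r1 : ((6 * k₁ * (k₁ + N₁) - 6 * (2 * k₁ + N₁) + 8) + (6 * k₂ * (k₂ + N₂) - 6 * (2 * k₂ + N₂) + 8)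
      + (6 * k₃ * (k₃ + N₃) - 6 * (2 * k₃ + N₃) + 8)) % 6 = 0 := by
    rw [h1, Int.add_mul_emod_self_left]; norm_num
  have r2 : (18 * m ^ 2 - 18 * m + 4) % 6 = 4 := by
    rw [h2, Int.add_mul_emod_self_left]; norm_num
  refine ⟨r1, r2, ?_⟩
  intro h
  rw [h] at r1
  omega

/-- COROLLARY A4 (report §7.4), bookkeeping: on a member `D ⊃ S_a ∪ S_{a′}` whose two theta-intersections share a curve `Z` of class `2γ` (the
numerically observed bitangent members, §7.2–7.3; `H·S̃_aS̃_{a′} = θ·Z = 8`, `H·S̃² = 0` by adjunction as in 2.2), a Weil divisor `W = kΘ|_D + nS_a + n′S_{a′}`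
has `Q_W = 48k + 24(n + n′)` and `P_W = 48k² + 48k(n + n′) + 16nn′`; the H2 conditions `Q_W = 72 + 48m`, `P_W = 16(3m² + 9m + 5)` force, with `u := k − m`,
`n + n′ = 3 − 2u` and `nn′ = 3u² − 9u + 5`, hence `(2n + 2u − 3)² = (n + n′)² − 4nn′ = −8u² + 24u − 11`. Recorded: the two reductions as identities.
[§7.4] -/
theorem shared_curve_purity_reduction (k m n n' : ℤ)
    (hQ : 48 * k + 24 * (n + n') = 72 + 48 * m)
    (hP : 48 * k ^ 2 + 48 * k * (n + n') + 16 * (n * n') = 16 * (3 * m ^ 2 + 9 * m + 5)) :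
    n + n' = 3 - 2 * (k - m) ∧ n * n' = 3 * (k - m) ^ 2 - 9 * (k - m) + 5 ∧
    (2 * n + 2 * (k - m) - 3) ^ 2 = -8 * (k - m) ^ 2 + 24 * (k - m) - 11 := by
  have h1 : n + n' = 3 - 2 * (k - m) := by omega
  have h2 : n * n' = 3 * (k - m) ^ 2 - 9 * (k - m) + 5 := by
    have h3 : 3 * k ^ 2 + 3 * k * (n + n') + n * n' = 3 * m ^ 2 + 9 * m + 5 := by linarith
    rw [h1] at h3
    nlinarith [h3]
  refine ⟨h1, h2, ?_⟩
  have h4 : n' = 3 - 2 * (k - m) - n := by linarith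
  subst h4
  nlinarith [h2]

/-- COROLLARY A4 (report §7.4): `−8u² + 24u − 11` is never a perfect square (`< 0` for `u ≤ 0` or `u ≥ 3`; `= 5` for `u ∈ {1, 2}`), so the system of
`shared_curve_purity_reduction` has NO integer solution: **no rank-one reflexive sheaf `𝒪_D(kΘ + nS_a + n′S_{a′}) ⊗ P` on a member whose two
theta-intersections share a class-`2γ` curve is H2-numerical either** — the purity verdict of COROLLARY A1 extends to the (numerically observed) bitangent
members, by a different arithmetic (discriminant `5`). Recorded: the non-existence. [§7.4] -/
theorem shared_curve_purity_obstruction (u n : ℤ) : (2 * n + 2 * u - 3) ^ 2 ≠ -8 * u ^ 2 + 24 * u - 11 := by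
  intro h
  have hsq : 0 ≤ (2 * n + 2 * u - 3) ^ 2 := sq_nonneg _
  by_cases hu : u ≤ 0
  · nlinarith
  by_cases hu' : 3 ≤ u
  · nlinarith
  have hu1 : 1 ≤ u := by omega
  have hu2 : u ≤ 2 := by omega
  interval_cases u
  · -- u = 1: (2n - 1)^2 = 5
    have hb : -2 ≤ n ∧ n ≤ 2 := by constructor <;> nlinarith
    obtain ⟨hb1, hb2⟩ := hb
    interval_cases n <;> omega
  · -- u = 2: (2n + 1)^2 = 5
    have hb : -2 ≤ n ∧ n ≤ 2 := by constructor <;> nlinarith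
    obtain ⟨hb1, hb2⟩ := hb
    interval_cases n <;> omega

/-- COROLLARY A4 (report §7.4), assembled: there are no integers `k, m, n, n′` with `48k + 24(n + n′) = 72 + 48m` and
`48k² + 48k(n + n′) + 16nn′ = 16(3m² + 9m + 5)`. Recorded: the assembled non-existence. [§7.4] -/
theorem shared_curve_no_pure_object (k m n n' : ℤ)
    (hQ : 48 * k + 24 * (n + n') = 72 + 48 * m)
    (hP : 48 * k ^ 2 + 48 * k * (n + n') + 16 * (n * n') = 16 * (3 * m ^ 2 + 9 * m + 5)) : False := by
  obtain ⟨_, _, h3⟩ := shared_curve_purity_reduction k m n n' hQ hP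
  exact shared_curve_purity_obstruction (k - m) n h3

/-- §7.3 (report), bookkeeping of the excess intersection: two theta-intersections `S_a`, `S_{a′}` (`S_a·S_{a′} = θ⁴ = 24` in `A`) meeting cleanly along a
curve `Z` of class `cγ` and genus `g_Z` (and in finitely many further points `R`) have excess contribution
`−deg T_Z − deg N_{Z/S_a} − deg N_{Z/S_{a′}} = (2g_Z − 2) − 2(2g_Z − 2 − 8c) = 16c − (2g_Z − 2)` (`K_S = 2θ|_S`, `θ·Z = 4c`), so `#R = 24 − 16c + 2g_Z − 2`;
the numerically observed `#R = 8` is equivalent to `g_Z = 8c − 7` — `c = 2, g_Z = 9`: an Abel–Prym curve (contribution `16`). Recorded: the arithmetic.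
[§7.3] -/
theorem shared_curve_excess_count (c gZ : ℤ) :
    (2 * gZ - 2) - 2 * (2 * gZ - 2 - 8 * c) = 16 * c - (2 * gZ - 2) ∧
    (24 - (16 * c - (2 * gZ - 2)) = 8 ↔ gZ = 8 * c - 7) ∧ (16 * 2 - (2 * 9 - 2) = (16 : ℤ)) := by
  refine ⟨by ring, by omega, by norm_num⟩

end H2TwoThetaHabitatAddendumA

end Summit.HodgeConjecture.HodgeConjecture.WeilTypeLadder
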